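import Summits.BirchSwinnertonDyer.BirchSwinnertonDyer.Theorems.AdditiveKolyvaginRoadManinFrameResidueProperTwistDegree
import Summits.BirchSwinnertonDyer.Rank1Residual.Additive.QuadraticTwistNewform
import Summits.BirchSwinnertonDyer.Rank1Residual.Additive.GordTwistExactLaw
import Summits.BirchSwinnertonDyer.Rank1Residual.Additive.UnramifiedBaseChange
import Literature.NumberTheory.EllipticCurves.Gamma1PeriodLatticeTwistProofs
import Literature.NumberTheory.EllipticCurves.ManinConstantQuadraticTwistAtTwoProofs
import Literature.NumberTheory.EllipticCurves.RootNumberTwistProofs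
import HarnessLib

/-!
# Route `AdditiveKolyvaginRoad`, crux `ManinFrameResidueProper` (stmt-BirchSwinnertonDyer-20483), line
# `birth`, stub S11 (`p ≥ 11`): EDIXHOVEN'S TWIST DICHOTOMY IN LATTICE FORM — `p ∤ c₀` for the strong
# unstarred curve ⟺ `Λ_f ⊆ g(χ_p) · Λ_{f ⊗ χ_p}` — a ONE-NEWFORM criterion (helper, `--supports`)

Cell `pub/bsd-wall` (D-0120, W-ALL row 2), seat `bsd-wall-manin-p1` (prover). THEOREMS ONLY (no
definition, no named fact, no `sorry`); NO route file is imported; nothing is booked, no item closed.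
Companion of `AdditiveKolyvaginRoadManinFrameResidueProperTwistDegree.lean` (p540328: the stub's
conclusion ⟺ the twist-DEGREE step). Here the same open content is put in the form in which
Edixhoven 1991 §4 states it (typescript L610–640, L695–704): for the strong curve `E` of Kodaira
type II/III/IV at `p` and the newform `f̃ = f ⊗ χ_{p*}` of its `p*`-twist, `δΛ_f ⊆ Λ_{f̃} ⊆ δ⁻¹Λ_f`
(`δ = g(χ_p)`, `δ² = p*`), and Manin's `p`-part at `E` is his "case 2" `Λ_{f̃} = δ⁻¹Λ_f`, i.e.
**`Λ_f ⊆ δ·Λ_{f̃}`** (against "case 1" `Λ_{f̃} = δΛ_f`: "then Manin's conjecture is false"). Since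
`δ·Λ_{f̃}` is spanned by the TWISTED CUSP SYMBOLS OF `f` (Stevens 1989 (5.5), tree
`gaussSum_mul_cuspSymbol_charTwist`: `δ·{∞, γ∞}_{f̃} = ∑_{u mod p} χ_p(u) {∞, γ∞ + u/p}_f`), the
criterion says: **the `χ_p`-twisted cusp symbols of `f` generate `Λ_f`** (equivalently span
`Λ_f/pΛ_f`) — a test on ONE space of modular symbols of level `p²N'`, Manin-free.
* §1 pure lattice algebra: `not_dvd_c_of_periodLattice_le` (`Λ_f ⊆ s·Λ(D̃.f)`, `s·Λ_C ⊆ Λ_V`, strong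
  `D`, `p ∤ c(D̃)` ⟹ `p ∤ c(D)`, via the prime-to-`p` multiplier `k Λ_{W̃} ⊆ Λ_C` and
  `(k c̃/c)Λ_V ⊆ Λ_V ⇒ k c̃/c ∈ ℤ`) and `periodLattice_le_of_not_dvd_c` (strong `D̃`, `Λ_V ⊆ s·Λ_C`,
  `s·Λ_f ⊆ Λ(D̃.f)`, `s² = ±p`, `p ∤ c(D)` ⟹ `Λ_f ⊆ s·Λ(D̃.f)`, Bezout with `gcd(k'c, p) = 1`).
* §2 the twist inputs: `neronLattice_twist_iff` (`Λ(W♭) = s⁻¹Λ(V)` when `ord_p Δ_min(V) < 6`: Pal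
  2012 Lemma 3.1 + `|u| = 1`), `gaussSum_jacobiChar_sq` (`g(χ_p)² = p*`), `charTwist_eq_and_eq`
  (`f̃ = f ⊗ χ` and `f = f̃ ⊗ χ` as cusp forms) and `gaussSum_mul_mem_periodLattice_twist` (Stevens
  (5.4) in the tree, both ways: `gΛ_f ⊆ Λ_{f̃}`, `gΛ_{f̃} ⊆ Λ_f`).
* §3 `not_dvd_c_iff_periodLattice_le_twist` — THE CRITERION, granted modularity, Edixhoven 1991
  Thm. 3 (both tree renderings) and Dokchitser–Dokchitser 2015 Thm. 5.1 (1) (used for `p ∤ c̃` at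
  the optimal curve of the twisted class).
References: [EdixhovenManin1991] §4; [Stevens1989] Lemma (5.4), (5.5); [Pal2012] Prop. 2.5, Lemma
3.1; [DokchitserDokchitser2015LocalInvariants] Thm. 5.1 (1); [SilvermanAEC2009] VII.1 Prop. 1.3(b),
X.5 Cor. 5.4; [JetchevSkinnerWan2017] §7.4.1 (prime-to-`p` isogeny multiplier).
-/

set_option autoImplicit false
-- the Theorems directory repeats the summit name (sibling precedent `SignedBaseChangeAssembly.lean`)
set_option linter.dupNamespace false

noncomputable section

open scoped Classical

open WeierstrassCurve NumberField Literature.NumberTheory.EllipticCurves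
  Literature.NumberTheory.EllipticCurves.ModularForms
  Literature.NumberTheory.EllipticCurves.Rank1Residual Literature.NumberTheory.QuadraticFields
  Literature.NumberTheory.DiophantineGeometry IsDedekindDomain Rat.HeightOneSpectrum
  Summit.BirchSwinnertonDyer.Rank1Residual Summit.BirchSwinnertonDyer.Rank1Residual.Additive

namespace Summit.BirchSwinnertonDyer.BirchSwinnertonDyer.Theorems.ManinFrameResidueProperTwistLattice

/-! ### §1 Pure lattice algebra -/

section Algebra

variable {V C Wt : WeierstrassCurve ℚ} [C.IsElliptic] [C.IsGloballyMinimal] [Wt.IsElliptic]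
  [Wt.IsGloballyMinimal] {p : ℕ} {N Nt : ℕ} [NeZero N] [NeZero Nt]

/-- **`Λ_f ⊆ s·Λ_{f̃}` forces `p ∤ c`** (pure lattice algebra): `D` a strong datum of `V`,
`s·Λ_C ⊆ Λ_V`, `C ∼ W̃` with `E_C[p]` irreducible, `D̃` any datum of `W̃` with `p ∤ c(D̃)`; the
prime-to-`p` multiplier `k Λ_{W̃} ⊆ Λ_C` gives `(k c̃/c)·Λ_V ⊆ Λ_V`, so `k c̃/c ∈ ℤ` and `c ∣ k c̃`.
[cite: JetchevSkinnerWan2017, §7.4.1 and Remark 43] [cite: SilvermanAEC2009, VI.4.1 and VI.5.3] -/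
theorem not_dvd_c_of_periodLattice_le (hp : p.Prime) (hirrC : C.HasIrreducibleModPGaloisRep p)
    (hiso : IsIsogenous Wt C) (D : ModularParametrizationData V N)
    (hopt : ∀ z ∈ D.L.lattice, ∃ w ∈ periodLattice D.f, z = D.c * w)
    {LC : PeriodPair} (hLC : IsNeronLatticeOf (C.baseChange ℂ) LC) {s : ℂ}
    (hCV : ∀ z ∈ LC.lattice, s * z ∈ D.L.lattice) (Dt : ModularParametrizationData Wt Nt)
    (hct : ¬ (p : ℤ) ∣ Dt.c)
    (hΛ : ∀ w ∈ periodLattice D.f, ∃ wt ∈ periodLattice Dt.f, w = s * wt) :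
    ¬ (p : ℤ) ∣ D.c := by
  obtain ⟨k, -, hpk, hk⟩ :=
    X11b.exists_int_mul_mem_lattice_not_dvd integral_neronScaling_of_isGloballyMinimal_holds hiso
      Dt.isNeronLattice hLC hp hirrC
  have hc0 : D.c ≠ 0 := D.maninConstant_ne_zero_holds
  have hc0ℂ : (D.c : ℂ) ≠ 0 := by exact_mod_cast hc0
  -- `(k c̃ / c) Λ_V ⊆ Λ_V`
  have key : ∀ z ∈ D.L.lattice, (((k * Dt.c : ℤ) : ℚ) / D.c : ℚ) * z ∈ D.L.lattice := by
    intro z hz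
    obtain ⟨w, hw, rfl⟩ := hopt z hz
    obtain ⟨wt, hwt, rfl⟩ := hΛ w hw
    have h1 : (Dt.c : ℂ) * wt ∈ Dt.L.lattice := Dt.smul_periodLattice_le wt hwt
    have h2 : (k : ℂ) * ((Dt.c : ℂ) * wt) ∈ LC.lattice := hk _ h1
    have h3 : s * ((k : ℂ) * ((Dt.c : ℂ) * wt)) ∈ D.L.lattice := hCV _ h2
    convert h3 using 1
    push_cast
    field_simp
  obtain ⟨m, hm⟩ := int_of_rat_mul_mem_lattice_self D.L _ key
  have hc0ℚ : (D.c : ℚ) ≠ 0 := by exact_mod_cast hc0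
  have hprod : m * D.c = k * Dt.c := by
    have h : ((m * D.c : ℤ) : ℚ) = ((k * Dt.c : ℤ) : ℚ) := by
      rw [Int.cast_mul, hm, div_mul_cancel₀ _ hc0ℚ]
    exact_mod_cast h
  intro hdvd
  have h2 : (p : ℤ) ∣ k * Dt.c := hprod ▸ dvd_mul_of_dvd_right hdvd m
  rcases (Nat.prime_iff_prime_int.mp hp).dvd_or_dvd h2 with h | h
  · exact hpk h
  · exact hct h

/-- **Conversely, `p ∤ c` forces `Λ_f ⊆ s·Λ_{f̃}`** (pure lattice algebra): `D` any datum of `V`,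
`Λ_V ⊆ s·Λ_C`, `C ∼ W̃` with `E_{W̃}[p]` irreducible, `D̃` STRONG for `W̃`, `s·Λ_f ⊆ Λ(D̃.f)`, `s² = ±p`;
with the prime-to-`p` multiplier `k' Λ_C ⊆ Λ_{W̃}`: `(k'c)·w ∈ s·Λ̃`, `±p·w = s·(s·w) ∈ s·Λ̃`, Bezout.
[cite: JetchevSkinnerWan2017, §7.4.1 and Remark 43] [cite: SilvermanAEC2009, VI.4.1 and VI.5.3] -/
theorem periodLattice_le_of_not_dvd_c (hp : p.Prime) (hirrt : Wt.HasIrreducibleModPGaloisRep p)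
    (hiso : IsIsogenous C Wt) (D : ModularParametrizationData V N)
    {LC : PeriodPair} (hLC : IsNeronLatticeOf (C.baseChange ℂ) LC) {s : ℂ}
    (hVC : ∀ z ∈ D.L.lattice, ∃ y ∈ LC.lattice, z = s * y) (Dt : ModularParametrizationData Wt Nt)
    (hoptt : ∀ z ∈ Dt.L.lattice, ∃ w ∈ periodLattice Dt.f, z = Dt.c * w)
    (hE1 : ∀ w ∈ periodLattice D.f, s * w ∈ periodLattice Dt.f) {d : ℤ} (hs : s ^ 2 = (d : ℂ))
    (hd : d = p ∨ d = -p) (hc : ¬ (p : ℤ) ∣ D.c) :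
    ∀ w ∈ periodLattice D.f, ∃ wt ∈ periodLattice Dt.f, w = s * wt := by
  obtain ⟨k, -, hpk, hk⟩ :=
    X11b.exists_int_mul_mem_lattice_not_dvd integral_neronScaling_of_isGloballyMinimal_holds hiso
      hLC Dt.isNeronLattice hp hirrt
  have hP : Prime (p : ℤ) := Nat.prime_iff_prime_int.mp hp
  -- `gcd(k c, d) = 1`
  have hcop : IsCoprime (k * D.c) d := by
    have h1 : IsCoprime (p : ℤ) (k * D.c) :=
      (hP.irreducible.coprime_iff_not_dvd).mpr fun h ↦ (hP.dvd_or_dvd h).elim hpk hc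
    rcases hd with rfl | rfl
    · exact h1.symm
    · exact h1.symm.neg_right
  obtain ⟨x, y, hxy⟩ := hcop
  intro w hw
  -- `(k c) w ∈ s Λ̃`
  have h1 : (D.c : ℂ) * w ∈ D.L.lattice := D.smul_periodLattice_le w hw
  obtain ⟨yC, hyC, hcy⟩ := hVC _ h1
  have h2 : (k : ℂ) * yC ∈ Dt.L.lattice := hk yC hyC
  obtain ⟨w₁, hw₁, he⟩ := hoptt _ h2
  have hA : ((k * D.c : ℤ) : ℂ) * w = s * ((Dt.c : ℂ) * w₁) := by
    push_cast
    calc (k : ℂ) * (D.c : ℂ) * w = (k : ℂ) * ((D.c : ℂ) * w) := by ring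
      _ = (k : ℂ) * (s * yC) := by rw [hcy]
      _ = s * ((k : ℂ) * yC) := by ring
      _ = s * ((Dt.c : ℂ) * w₁) := by rw [he]
  have hA' : (Dt.c : ℂ) * w₁ ∈ periodLattice Dt.f := by
    rw [← zsmul_eq_mul]
    exact zsmul_mem hw₁ _
  -- `d w = s (s w)` with `s w ∈ Λ̃`
  have hB : ((d : ℤ) : ℂ) * w = s * (s * w) := by rw [← mul_assoc, ← sq, hs]
  have hB' : s * w ∈ periodLattice Dt.f := hE1 w hw
  -- Bezout
  refine ⟨(x : ℂ) * ((Dt.c : ℂ) * w₁) + (y : ℂ) * (s * w), ?_, ?_⟩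
  · refine add_mem ?_ ?_
    · rw [← zsmul_eq_mul]; exact zsmul_mem hA' _
    · rw [← zsmul_eq_mul]; exact zsmul_mem hB' _
  · have h1' : w = ((x * (k * D.c) + y * d : ℤ) : ℂ) * w := by rw [hxy]; push_cast; ring
    calc w = ((x * (k * D.c) + y * d : ℤ) : ℂ) * w := h1'
      _ = (x : ℂ) * (((k * D.c : ℤ) : ℂ) * w) + (y : ℂ) * (((d : ℤ) : ℂ) * w) := by
          push_cast; ring
      _ = s * ((x : ℂ) * ((Dt.c : ℂ) * w₁) + (y : ℂ) * (s * w)) := by rw [hA, hB]; ring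

end Algebra

/-! ### §2 The twist inputs: the Néron lattice of `W♭` and Stevens' sandwich `gΛ_f ⊆ Λ_{f̃}`, `gΛ_{f̃} ⊆ Λ_f` -/

section TwistInputs

variable {p : ℕ} [hp : Fact p.Prime]

/-- **`Λ(W♭) = s⁻¹Λ(V)` as sets** for a globally minimal `W♭ = C • V^{(p*)}` with `ord_p Δ_min(V) < 6`,
`s² = p*`: the twisted equation has Néron pair `s⁻¹L_V` (`isNeronLatticeOf_quadraticTwist_of_sq_eq`)
and `|u(C)| = 1` (`abs_u_eq_one_of_twist_pStar`). [cite: Pal2012, Prop. 2.5 and Lemma 3.1] -/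
theorem neronLattice_twist_iff (hp2 : p ≠ 2) (V W : WeierstrassCurve ℚ) [V.IsElliptic]
    [V.IsGloballyMinimal] [W.IsElliptic] [W.IsGloballyMinimal]
    (hV6 : padicValInt p V.minimalDiscriminantInt < 6) (C : VariableChange ℚ)
    (hC : C • V.quadraticTwist ((-1 : ℚ) ^ (p / 2) * p) = W) {LV LW : PeriodPair}
    (hLV : IsNeronLatticeOf (V.baseChange ℂ) LV) (hLW : IsNeronLatticeOf (W.baseChange ℂ) LW)
    {s : ℂ} (hs : s ^ 2 = (((-1 : ℤ) ^ (p / 2) * p : ℤ) : ℂ)) (z : ℂ) :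
    z ∈ LW.lattice ↔ s * z ∈ LV.lattice := by
  obtain ⟨hcast, hd⟩ := pStar_intCast p
  have hs0 : s ≠ 0 := by
    rintro rfl
    have h0 : (((-1 : ℤ) ^ (p / 2) * p : ℤ) : ℂ) = 0 := by rw [← hs]; simp
    rcases hd with h | h <;> rw [h] at h0 <;> simp [hp.out.ne_zero] at h0
  have hsq : s ^ 2 = (((-1 : ℚ) ^ (p / 2) * p : ℚ) : ℂ) := by
    rw [hs, ← hcast]; push_cast; ring
  have hLT : IsNeronLatticeOf ((V.quadraticTwist ((-1 : ℚ) ^ (p / 2) * p)).baseChange ℂ)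
      (LV.mulLeft s⁻¹ (inv_ne_zero hs0)) :=
    isNeronLatticeOf_quadraticTwist_of_sq_eq _ hLV hs0 hsq
  have hLW' : IsNeronLatticeOf ((C • V.quadraticTwist ((-1 : ℚ) ^ (p / 2) * p)).baseChange ℂ) LW := by
    rw [hC]; exact hLW
  have hΛ := IsNeronLatticeOf.lattice_eq_mulLeft_of_smul C hLT hLW'
  have hu : |(C.u : ℚ)| = 1 := abs_u_eq_one_of_twist_pStar p hp2 V W hV6 C hC
  rw [hΛ, PeriodPair.mem_mulLeft_lattice, PeriodPair.mem_mulLeft_lattice, inv_inv, ← mul_assoc]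
  rcases abs_eq (zero_le_one) |>.mp hu with h1 | h1
  · rw [h1]; simp
  · rw [h1]
    simp only [Rat.cast_neg, Rat.cast_one, inv_neg, inv_one, mul_neg, mul_one, neg_mul]
    exact neg_mem_iff

/-- **`p² ∣ N(W)` at an additive `p ≥ 5`** (`f_p = 2`: `condExpTwo_of_addv_of_five_le`; the conductor
is `∏ p^{f_p}`, `factorization_conductorNorm_primesEquiv_symm`). [cite: SilvermanAEC2009, C.16] -/
theorem sq_dvd_conductorNorm_of_addv (hp5 : 5 ≤ p) (W : WeierstrassCurve ℚ) [W.IsElliptic]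
    (hadd : Addv W p) : p ^ 2 ∣ W.conductorNorm ℤ := by
  have hN : W.conductorNorm ℤ ≠ 0 := (conductorNorm_pos_holds W).ne'
  refine (hp.out.pow_dvd_iff_le_factorization hN).mpr ?_
  have hfac : (W.conductorNorm ℤ).factorization p = condExp W p :=
    factorization_conductorNorm_primesEquiv_symm W ⟨p, hp.out⟩
  have h2 : condExp W p = 2 := condExpTwo_of_addv_of_five_le W p hp5 hadd
  rw [hfac, h2]

/-- **`g(χ_p)² = p*`** for the Jacobi (= Legendre) character modulo the odd prime `p` and the standard
additive character (Mathlib `gaussSum_sq`: `g² = χ(−1)·p`, `χ_p(−1) = χ₄(p) = (−1)^{(p−1)/2}`).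
[cite: IrelandRosen1982, Ch. 6 §3 Prop. 6.3.2] -/
theorem gaussSum_jacobiChar_sq (hp2 : p ≠ 2) :
    haveI : NeZero p := ⟨hp.out.ne_zero⟩
    gaussSum (jacobiChar p) (ZMod.stdAddChar (N := p)) ^ 2 = (((-1 : ℤ) ^ (p / 2) * p : ℤ) : ℂ) := by
  haveI : NeZero p := ⟨hp.out.ne_zero⟩
  have hodd : Odd p := hp.out.odd_of_ne_two hp2
  have hne : jacobiChar p ≠ 1 := jacobiChar_ne_one hodd hp.out.squarefree hp.out.one_lt.ne'
  have hmod : p % 2 = 1 := Nat.odd_iff.mp hodd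
  rw [gaussSum_sq hne (jacobiChar_isQuadratic' p) (ZMod.isPrimitive_stdAddChar p), ZMod.card,
    show ((-1 : ZMod p) : ZMod p) = ((-1 : ℤ) : ZMod p) by push_cast; rfl, jacobiChar_intCast,
    jacobiSym.at_neg_one hodd, ZMod.χ₄_nat_eq_if_mod_four, if_neg (by omega)]
  rcases Nat.odd_mod_four_iff.mp hmod with h1 | h3
  · rw [if_pos h1, show p / 2 = 2 * (p / 4) by omega, pow_mul]; push_cast; ring
  · rw [if_neg (by omega), show p / 2 = 2 * (p / 4) + 1 by omega, pow_succ, pow_mul]; push_cast; ring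

/-- **The newform of the twisted class IS the `χ_p`-twist of `f`, and conversely** (as cusp forms,
`q`-expansion principle): `V` additive at `p ≥ 5`, `W♭ = C • V^{(p*)}` minimal and additive at `p`,
`W̃ ∼ W♭`; `aₙ(f_{W̃}) = (n/p)·aₙ(f_V)`, `aₙ(f_V) = (n/p)·aₙ(f_{W̃})` (`cuspCoeff_eq_legendreSym_mul_cuspCoeff`).
[cite: MazurTateTeitelbaum1986Invent, §I.8] [cite: SilvermanAEC2009, X.5 Cor. 5.4] -/
theorem charTwist_eq_and_eq (hp5 : 5 ≤ p) (V Wf Wt : WeierstrassCurve ℚ) [V.IsElliptic]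
    [V.IsGloballyMinimal] [Wf.IsElliptic] [Wf.IsGloballyMinimal] [Wt.IsElliptic]
    (hV : Addv V p) (hWf : Addv Wf p) (C : VariableChange ℚ)
    (hC : C • V.quadraticTwist ((-1 : ℚ) ^ (p / 2) * p) = Wf) (hiso : IsIsogenous Wf Wt)
    {N Nt : ℕ} [NeZero N] [NeZero Nt] (D : ModularParametrizationData V N)
    (Dt : ModularParametrizationData Wt Nt) (hN : N ∣ Nt) (hm : p ^ 2 ∣ Nt) (hN' : Nt ∣ N)
    (hm' : p ^ 2 ∣ N) :
    haveI : NeZero p := ⟨hp.out.ne_zero⟩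
    charTwist Nt hN hm (jacobiChar_isQuadratic' p) D.f = Dt.f ∧
      charTwist N hN' hm' (jacobiChar_isQuadratic' p) Dt.f = D.f := by
  haveI : NeZero p := ⟨hp.out.ne_zero⟩
  have hp2 : p ≠ 2 := by omega
  have hodd : Odd p := hp.out.odd_of_ne_two hp2
  have hprim : (jacobiChar p).IsPrimitive := isPrimitive_jacobiChar hodd hp.out.squarefree
  obtain ⟨hcast, hd⟩ := pStar_intCast p
  have hd0 : ((-1 : ℚ) ^ (p / 2) * p) ≠ 0 :=
    mul_ne_zero (pow_ne_zero _ (by norm_num)) (by exact_mod_cast hp.out.ne_zero)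
  have hv := primesEquiv_symm_apply_coe p
  -- the newform of `W̃` is a newform of `W♭` and of the twisted equation `V^{(p*)}`
  have hfW : IsNewformOf Wf Dt.f := Dt.isNewformOf.of_isIsogenous hiso
  haveI : (V.quadraticTwist ((-1 : ℚ) ^ (p / 2) * p)).IsElliptic := V.isElliptic_quadraticTwist hd0
  have hfT : IsNewformOf (V.quadraticTwist (((-1 : ℤ) ^ (p / 2) * p : ℤ) : ℚ)) Dt.f := by
    rw [hcast]
    refine IsNewformOf.of_smul C ?_
    rw [hC]; exact hfW
  -- `V` is a model of the `p*`-twist of `W♭`: `(X E) • V = W♭^{(p*)}`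
  obtain ⟨E, hE⟩ := exists_quadraticTwist_quadraticTwist_eq_smul V hd0
  have hVeq : ((⟨C.u, ((-1 : ℚ) ^ (p / 2) * p) * C.r, 0, 0⟩ : VariableChange ℚ) * E) • V =
      Wf.quadraticTwist ((-1 : ℚ) ^ (p / 2) * p) := by
    rw [mul_smul, ← hE, ← WeierstrassCurve.quadraticTwist_smul, hC]
  haveI : (Wf.quadraticTwist ((-1 : ℚ) ^ (p / 2) * p)).IsElliptic := by rw [← hVeq]; infer_instance
  have hfT' : IsNewformOf (Wf.quadraticTwist (((-1 : ℤ) ^ (p / 2) * p : ℤ) : ℚ)) D.f := by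
    rw [hcast, ← hVeq]
    refine IsNewformOf.of_smul ((⟨C.u, ((-1 : ℚ) ^ (p / 2) * p) * C.r, 0, 0⟩ : VariableChange ℚ) * E)⁻¹ ?_
    rw [inv_smul_smul]; exact D.isNewformOf
  -- coefficient relations from additivity at `p`
  have h1 : ∀ n : ℕ, cuspCoeff Dt.f n = jacobiChar p n * cuspCoeff D.f n := fun n ↦ by
    rw [jacobiChar_natCast, ← jacobiSym.legendreSym.to_jacobiSym]
    exact Wf.cuspCoeff_eq_legendreSym_mul_cuspCoeff hp2 hv (hasAdditiveReductionAt_of_addv Wf p hWf)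
      hfW hfT' n
  have h2 : ∀ n : ℕ, cuspCoeff D.f n = jacobiChar p n * cuspCoeff Dt.f n := fun n ↦ by
    rw [jacobiChar_natCast, ← jacobiSym.legendreSym.to_jacobiSym]
    exact V.cuspCoeff_eq_legendreSym_mul_cuspCoeff hp2 hv (hasAdditiveReductionAt_of_addv V p hV)
      D.isNewformOf hfT n
  exact ⟨eq_of_forall_cuspCoeff_eq_gamma0 fun n ↦ by rw [cuspCoeff_charTwist Nt hN hm _ hprim, h1 n],
    eq_of_forall_cuspCoeff_eq_gamma0 fun n ↦ by rw [cuspCoeff_charTwist N hN' hm' _ hprim, h2 n]⟩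

/-- **Edixhoven's sandwich `gΛ_f ⊆ Λ_{f̃}`, `gΛ_{f̃} ⊆ Λ_f`** (`g = g(χ_p)`; typescript L618–621 "by a
standard computation, `δΛ ⊂ Λ̃ ⊂ δ⁻¹Λ`"), for the newforms `f = D.f` of `V` and `f̃ = D̃.f` of any
`W̃ ∼ W♭`: Stevens 1989 Lemma (5.4) as PROVED in the tree for `Γ₀`-period lattices
(`gaussSum_mul_mem_periodLattice_of_mem_charTwist`) applied to `f̃ = f ⊗ χ` and to `f = f̃ ⊗ χ`.
[cite: EdixhovenManin1991, §4 (typescript L618–621)] [cite: Stevens1989, Lemma (5.4)] -/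
theorem gaussSum_mul_mem_periodLattice_twist (hnf : exists_isNewformOf) (hp5 : 5 ≤ p)
    (V Wf Wt : WeierstrassCurve ℚ) [V.IsElliptic] [V.IsGloballyMinimal] [Wf.IsElliptic]
    [Wf.IsGloballyMinimal] [Wt.IsElliptic] (hV : Addv V p) (hWf : Addv Wf p) (C : VariableChange ℚ)
    (hC : C • V.quadraticTwist ((-1 : ℚ) ^ (p / 2) * p) = Wf) (hiso : IsIsogenous Wf Wt)
    [NeZero (V.conductorNorm ℤ)] [NeZero (Wt.conductorNorm ℤ)]
    (D : ModularParametrizationData V (V.conductorNorm ℤ))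
    (Dt : ModularParametrizationData Wt (Wt.conductorNorm ℤ)) :
    haveI : NeZero p := ⟨hp.out.ne_zero⟩
    (∀ w ∈ periodLattice D.f,
        gaussSum (jacobiChar p) (ZMod.stdAddChar (N := p)) * w ∈ periodLattice Dt.f) ∧
      ∀ z ∈ periodLattice Dt.f,
        gaussSum (jacobiChar p) (ZMod.stdAddChar (N := p)) * z ∈ periodLattice D.f := by
  haveI : NeZero p := ⟨hp.out.ne_zero⟩
  have hp2 : p ≠ 2 := by omega
  have hprim : (jacobiChar p).IsPrimitive :=
    isPrimitive_jacobiChar (hp.out.odd_of_ne_two hp2) hp.out.squarefree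
  -- the two levels coincide: `N(W̃) = N(W♭) = N(V)`
  have hNt : Wt.conductorNorm ℤ = V.conductorNorm ℤ := by
    rw [← conductorNorm_eq_of_twist_pStar p hp5 V Wf hV hWf C hC]
    exact IsNewformOf.level_eq_conductorNorm_of_exists_isNewformOf hnf
      (Dt.isNewformOf.of_isIsogenous hiso)
  have hmV : p ^ 2 ∣ V.conductorNorm ℤ := sq_dvd_conductorNorm_of_addv hp5 V hV
  have hmt : p ^ 2 ∣ Wt.conductorNorm ℤ := hNt ▸ hmV
  obtain ⟨h1, h2⟩ := charTwist_eq_and_eq hp5 V Wf Wt hV hWf C hC hiso D Dt hNt.symm.dvd hmt hNt.dvd hmV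
  refine ⟨fun w hw ↦ ?_, fun z hz ↦ ?_⟩
  · refine gaussSum_mul_mem_periodLattice_of_mem_charTwist (V.conductorNorm ℤ) hNt.dvd hmV
      (jacobiChar_isQuadratic' p) hprim Dt.f ?_
    rw [h2]; exact hw
  · refine gaussSum_mul_mem_periodLattice_of_mem_charTwist (Wt.conductorNorm ℤ) hNt.symm.dvd hmt
      (jacobiChar_isQuadratic' p) hprim D.f ?_
    rw [h1]; exact hz

end TwistInputs

/-! ### §3 The criterion: `p ∤ c(D)` ⟺ `Λ_f ⊆ g(χ_p)·Λ_{f̃}` -/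

section Criterion

variable {p : ℕ} [hp : Fact p.Prime]

/-- **EDIXHOVEN'S DICHOTOMY AS A ONE-SIDED LATTICE CRITERION.** `V/ℚ` globally minimal, additive
at `p ≥ 11`, `TypeGOrd V p`, `ord_p Δ_min(V) ≤ 4` (Kodaira II/III/IV), `E[p]` irreducible, `D` a
STRONG conductor-level datum of `V` (`Λ_V ⊆ c·Λ_f`, the optimal curve, `c = c₀`); `W♭` a globally
minimal model of `V ⊗ χ_{p*}`; `W̃ ∼ W♭` globally minimal with a STRONG conductor-level datum `D̃`
(the optimal curve of the twisted class). GRANTED `hnf`, Edixhoven 1991 Thm. 3 (`hEdx`, `hEdxK`) and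
Dokchitser–Dokchitser 2015 Thm. 5.1 (1) (`hDD`): **`p ∤ c(D)` ⟺ every period of `f = D.f` is
`g(χ_p)` times a period of `f̃ = D̃.f`** (Edixhoven's "case 2"; its negation is "case 1", "Manin's
conjecture is false"); `g·Λ_{f̃}` being generated by the twisted cusp symbols
`∑_{u mod p} χ_p(u)·{∞, γ∞ + u/p}_f`, this is a test on the modular symbols of `f` alone.
[cite: EdixhovenManin1991, Thm. 3 and §4 (typescript L618–640, L695–704)]
[cite: Stevens1989, Lemma (5.4), (5.5)] [cite: DokchitserDokchitser2015LocalInvariants, Thm. 5.1 (1)] -/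
theorem not_dvd_c_iff_periodLattice_le_twist (hnf : exists_isNewformOf)
    (hEdx : edixhoven_not_dvd_maninConstant_of_not_potentiallyGoodOrdinary)
    (hEdxK : edixhoven_not_dvd_maninConstant_of_kodairaSymbol_ne)
    (hDD : dokchitser_padicValInt_minimalDiscriminantInt_eq_of_isogeny_of_not_dvd_degree)
    (hp11 : 11 ≤ p) (V : WeierstrassCurve ℚ) [V.IsElliptic] [V.IsGloballyMinimal]
    [NeZero (V.conductorNorm ℤ)] (hV : Addv V p) (hirr : Irr V p) (hG : TypeGOrd V p)
    (hV4 : padicValInt p V.minimalDiscriminantInt ≤ 4)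
    (D : ModularParametrizationData V (V.conductorNorm ℤ))
    (hopt : ∀ z ∈ D.L.lattice, ∃ w ∈ periodLattice D.f, z = D.c * w)
    (Wf : WeierstrassCurve ℚ) [Wf.IsElliptic] [Wf.IsGloballyMinimal] (C : VariableChange ℚ)
    (hC : C • V.quadraticTwist ((-1 : ℚ) ^ (p / 2) * p) = Wf)
    (Wt : WeierstrassCurve ℚ) [Wt.IsElliptic] [Wt.IsGloballyMinimal] [NeZero (Wt.conductorNorm ℤ)]
    (hiso : IsIsogenous Wf Wt) (Dt : ModularParametrizationData Wt (Wt.conductorNorm ℤ))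
    (hoptt : ∀ z ∈ Dt.L.lattice, ∃ w ∈ periodLattice Dt.f, z = Dt.c * w) :
    haveI : NeZero p := ⟨hp.out.ne_zero⟩
    ¬ (p : ℤ) ∣ D.c ↔
      ∀ w ∈ periodLattice D.f, ∃ wt ∈ periodLattice Dt.f,
        w = gaussSum (jacobiChar p) (ZMod.stdAddChar (N := p)) * wt := by
  haveI : NeZero p := ⟨hp.out.ne_zero⟩
  have hp2 : p ≠ 2 := by omega
  have hp5 : 5 ≤ p := by omega
  have hj : 0 ≤ padicValRat p V.j := padicValRat_j_nonneg_of_typeGOrd V p hG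
  have hV6 : padicValInt p V.minimalDiscriminantInt < 6 := by omega
  obtain ⟨hWf, -, h6⟩ := addv_of_twist_pStar p hp2 V Wf hj hV6 C hC
  -- `E♭[p]`, `Ẽ[p]` irreducible
  have hd0 : ((-1 : ℚ) ^ (p / 2) * p) ≠ 0 :=
    mul_ne_zero (pow_ne_zero _ (by norm_num)) (by exact_mod_cast hp.out.ne_zero)
  have hC' : C⁻¹ • Wf = V.quadraticTwist ((-1 : ℚ) ^ (p / 2) * p) := by rw [← hC, inv_smul_smul]
  have hirrf : Irr Wf p :=
    BurungaleSkinnerTianWan2024.hasIrreducibleModPGaloisRep_of_smul_eq_quadraticTwist V Wf p hd0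
      hC' hirr
  have hirrt : Irr Wt p := (X12.irr_iff_of_isIsogenous hiso p).mp hirrf
  -- `p ∤ c(D̃)`: Edixhoven at `W̃`, off the exception granted Dokchitser–Dokchitser
  have haddt : Addv Wt p := (X2.addv_iff_of_isIsogenous (p := p) hiso).mp hWf
  have hct : ¬ (p : ℤ) ∣ Dt.c :=
    Addv.not_dvd_maninConstant_of_exception Wt p hEdx hEdxK Dt hoptt (by omega) haddt
      (ManinFrameResidueProperTwistDegree.not_typeGOrd_or_four_lt_of_isIsogenous hDD hp5 hWf hirrf
        hiso (by omega))
  -- a Néron pair of `W♭` and the relation `Λ(W♭) = g⁻¹Λ(V)`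
  obtain ⟨LC, hLC⟩ := exists_isNeronLatticeOf_holds (Wf.baseChange ℂ)
  have hs := gaussSum_jacobiChar_sq (p := p) hp2
  have hΛ := neronLattice_twist_iff hp2 V Wf hV6 C hC D.isNeronLattice hLC hs
  have hCV : ∀ z ∈ LC.lattice,
      gaussSum (jacobiChar p) (ZMod.stdAddChar (N := p)) * z ∈ D.L.lattice :=
    fun z hz ↦ (hΛ z).mp hz
  have hg0 : gaussSum (jacobiChar p) (ZMod.stdAddChar (N := p)) ≠ 0 := by
    intro h0
    obtain ⟨-, hd⟩ := pStar_intCast p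
    have h' : (((-1 : ℤ) ^ (p / 2) * p : ℤ) : ℂ) = 0 := by rw [← hs, h0]; simp
    rcases hd with h | h <;> rw [h] at h' <;> simp [hp.out.ne_zero] at h'
  have hVC : ∀ z ∈ D.L.lattice, ∃ y ∈ LC.lattice,
      z = gaussSum (jacobiChar p) (ZMod.stdAddChar (N := p)) * y := fun z hz ↦
    ⟨(gaussSum (jacobiChar p) (ZMod.stdAddChar (N := p)))⁻¹ * z,
      (hΛ _).mpr (by rwa [← mul_assoc, mul_inv_cancel₀ hg0, one_mul]),
      by rw [← mul_assoc, mul_inv_cancel₀ hg0, one_mul]⟩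
  -- Stevens' sandwich
  obtain ⟨hE1, -⟩ := gaussSum_mul_mem_periodLattice_twist hnf hp5 V Wf Wt hV hWf C hC hiso D Dt
  obtain ⟨-, hd⟩ := pStar_intCast p
  exact ⟨periodLattice_le_of_not_dvd_c hp.out hirrt hiso D hLC hVC Dt hoptt hE1 hs hd,
    not_dvd_c_of_periodLattice_le hp.out hirrf hiso.symm_of_charZero D hopt hLC hCV Dt hct⟩

end Criterion

end Summit.BirchSwinnertonDyer.BirchSwinnertonDyer.Theorems.ManinFrameResidueProperTwistLattice

end
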